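import Mathlib
import Literature.AlgebraicGeometry.Resolution.Lipman1969RationalSurfaceSingularities
import Literature.AlgebraicGeometry.Resolution.ResolutionFibreDimension
import Literature.AlgebraicGeometry.Morphisms.CechModuleBiproduct
import Literature.AlgebraicGeometry.Morphisms.CechH2FibreDimOne
import Literature.AlgebraicGeometry.Modules.AffineLocalizingClosure
import Literature.AlgebraicGeometry.Modules.CohFinitePresentation
import Literature.AlgebraicGeometry.Modules.IsoOfSectionsOnBasis
import Literature.AlgebraicGeometry.Morphisms.FormalModuleAffine
import Summits.ResolutionOfSingularities.ResolutionOfSingularities.Theorems.HomologicalConductorNoZenoFullSheafMaps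
import Summits.ResolutionOfSingularities.ResolutionOfSingularities.Theorems.HomologicalConductorNoZenoGWH2Instance
import HarnessLib

/-!
# Crux `NoZenoR` (stmt-ResolutionOfSingularities-19943), line `sandwich-cluster`, G-layer G2 (iii):
# the presentation `𝒪_X^n ⟶ 𝒪_X · S` and `Ȟ¹(𝒰, M~) = 0` for the full sheaf of a finite module

OURS (cell res-hironaka, chain W4.4; KERNEL-L0 §16 R6 row G2 «full-sheaf package», clause (iii) of the
holder's cut (res-D-pv-045 AS res-L0-w44-stub-8, `SketchG2Split.lean` 4f3b6bfe6d08dd54), seat res-D-pv-024).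
Sequel of `…Theorems.HomologicalConductorNoZenoFullSheaf{,Affine,Maps}` (the object
`generatedSheaf V S = 𝒪_X · S ⊆ V_X` on an integral `X`, its sections over affine opens, the maps
`toGenerated s : 𝒪_X ⟶ 𝒪_X · S`). Nothing of [claim: Hironaka2017] is used; AI-written, weaker than
expert review.

* `presentation V S s : 𝒪_X^n ⟶ 𝒪_X · S` — the morphism out of `𝒪_X^n = Morphisms.freeMod X n` attached
  to a family `s : Fin n → S` (Mathlib `SheafOfModules.freeHomEquiv`; `presentation_app_freeSection`);
* `presentation_app_surjective` — it is surjective on the sections over `U` as soon as the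
  `σ_{s i}|_U` span `Γ(U, 𝒪_X · S)`; `epi_presentation`; `shortExact_kernel_presentation` — the
  presentation sequence `0 → 𝒦 → 𝒪_X^n → 𝒪_X · S → 0`; `isAffineLocalizing_kernel_presentation`;
* `evalFn_res_algebraMapΓ`, `ofMem_map_smul` — for the FULL SHEAF `M~ = 𝒪_X · φ(M)` of a
  `T`-module `M` (`π : X → Spec T`, `φ : M →+ K(X)^r` semilinear along `baseToFunctionField π`):
  `σ_{φ(a • m)} = a|_U • σ_{φ(m)}`, whence `span_range_ofMem_generators_eq_top`: the sections attached
  to `T`-GENERATORS of `M` already span `Γ(U, M~)` over every non-empty affine `U`;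
* **`fullSheaf_cechMH1_subsingleton`** — G2 (iii): for `T` a Noetherian local domain of Krull
  dimension `2`, `π : X ⟶ Spec T` a resolution with `Ȟ¹(𝒰, 𝒪_X) = 0` on finite affine covers
  (`HasTrivialCechH1 π`, rationality) and `M` a finite `T`-module: **`Ȟ¹(𝒰, M~) = 0` on every finite
  affine open cover `𝒰`** — `M~` is a quotient of `𝒪_X^n` (`n` generators of `M`) with
  affine-localizing kernel, `Ȟ¹(𝒰, 𝒪_X^n) = 0`, and `Ȟ¹` is right exact on the curve-fibred proper `X`
  (`Morphisms/CechModuleBiproduct`, `CechModuleH2`) modulo the named fact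
  `GortzWedhorn2023_24_44_H2` (Görtz–Wedhorn II Cor. 24.44 = EGA III (4.2.2): `Ȟ² = 0` above the fibre
  dimension), whose fibre hypothesis is `IsResolution.topologicalKrullDim_fiber_le_one`.
  Artin–Verdier 1985 (1.1)(ii) «`R¹π_* M~ = 0`» for rational double points; here for any resolution of
  a two-dimensional local domain with `H¹(𝒪_X) = 0`, any `M` (reflexivity is not needed for (iii)).

* `fullSheaf_cechMH1_subsingleton_inst` (APPENDED 2026-08-28, res-inputs-p-6; V35c recipe §R3 first consumer) — the same
  G2 (iii) statement with the named-fact binder replaced by the weaker OURS instance `NoZeno.GWH2ProperBirationalDim2`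
  (`…Theorems.HomologicalConductorNoZenoGWH2Instance`, DR-F53 (a)); the original theorem is untouched.

* `fullSheaf_cechMH1_subsingleton_instRes` (APPENDED 2026-08-28, res-inputs-p-6; desk re-cut r2 / §R3b) — the same statement
  under the resolution instance `NoZeno.GWH2ResolutionDim2` (`ringKrullDim = 2` form); the two theorems before it are untouched.

References: M. Artin, J.-L. Verdier, Math. Ann. 270 (1985) 79–82, Lemma (1.1) [`ArtinVerdier1985`];
U. Görtz, T. Wedhorn, *Algebraic Geometry II* (2023), Cor. 24.44 [`GortzWedhorn2023`];
R. Hartshorne, *Algebraic Geometry* (1977), III Thm. 4.5 [`Hartshorne1977`].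
-/

-- single-problem summit: the doubled namespace component `ResolutionOfSingularities` is forced
set_option linter.dupNamespace false

noncomputable section

universe u

open CategoryTheory CategoryTheory.Limits AlgebraicGeometry TopologicalSpace Opposite
open Literature.AlgebraicGeometry.Resolution Literature.AlgebraicGeometry.Morphisms
open Literature.AlgebraicGeometry.Modules

namespace Summit.ResolutionOfSingularities.ResolutionOfSingularities.Theorems.NoZeno.SandwichCluster.FullSheaf

variable {X : Scheme.{u}} [IsIntegral X]
variable (V : Type u) [AddCommGroup V] [Module X.functionField V] (S : Set V)

attribute [local instance] stalkModule stalk_isScalarTower fnModule baseModule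

/-! ## The presentation `𝒪_X^n ⟶ 𝒪_X · S` attached to a finite family of elements of `S` -/

/-- **The presentation morphism `𝒪_X^n ⟶ 𝒪_X · S`** attached to a family `s : Fin n → S`: the basis
section `e_i` of `𝒪_X^n = freeMod X n` goes to the global section `σ_{s i}` with constant value `s i`
(Mathlib `SheafOfModules.freeHomEquiv`, as in `Morphisms.freeHomOfSections`). [this work] -/
def presentation {n : ℕ} (s : Fin n → S) : freeMod X n ⟶ generatedSheaf V S :=
  show (SheafOfModules.free (ULift.{u} (Fin n)) : X.Modules) ⟶ generatedSheaf V S from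
    (generatedSheaf V S).freeHomEquiv.symm fun i => globalSectionOfMem V S (s i.down).1 (s i.down).2

/-- The section `σ_{s i}|_U` is the image of the `i`-th basis section over `U`. [this work] -/
theorem presentation_app_freeSection {n : ℕ} (s : Fin n → S) (i : Fin n) (U : X.Opens) :
    (presentation V S s).app U
        ((SheafOfModules.freeSection (R := X.ringCatSheaf) (ULift.up i)).val (op U)) =
      ofMem V S U (s i).1 (s i).2 := by
  have h := SheafOfModules.sectionsMap_freeHomEquiv_symm_freeSection (M := generatedSheaf (X := X) V S)
    (fun i : ULift.{u} (Fin n) => globalSectionOfMem V S (s i.down).1 (s i.down).2) (ULift.up i)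
  exact congrArg (fun σ : (generatedSheaf (X := X) V S).sections => σ.val (op U)) h

/-- **Surjectivity on sections from generation**: if the sections `σ_{s i}|_U` span `Γ(U, 𝒪_X · S)`
over `Γ(X, U)`, the presentation is surjective on the sections over `U`. [this work] -/
theorem presentation_app_surjective {n : ℕ} (s : Fin n → S) (U : X.Opens)
    (hgen : Submodule.span Γ(X, U)
      (Set.range fun i => (ofMem V S U (s i).1 (s i).2 : Γ(generatedSheaf V S, U))) = ⊤) :
    Function.Surjective ((presentation V S s).app U) := by
  intro y
  have hy : y ∈ Submodule.span Γ(X, U)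
      (Set.range fun i => (ofMem V S U (s i).1 (s i).2 : Γ(generatedSheaf V S, U))) := by
    rw [hgen]; trivial
  induction hy using Submodule.span_induction with
  | mem w hw =>
    obtain ⟨i, rfl⟩ := hw
    exact ⟨_, presentation_app_freeSection V S s i U⟩
  | zero => exact ⟨0, map_zero _⟩
  | add w w' _ _ hw hw' =>
    obtain ⟨x, rfl⟩ := hw
    obtain ⟨x', rfl⟩ := hw'
    exact ⟨x + x', map_add _ _ _⟩
  | smul g w _ hw =>
    obtain ⟨x, rfl⟩ := hw
    exact ⟨g • x, Scheme.Modules.Hom.app_smul _ _ _⟩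

/-- **The presentation is an epimorphism** as soon as the `σ_{s i}` generate the sections over every
non-empty affine open (over an empty open all sections vanish). [this work] -/
theorem epi_presentation {n : ℕ} (s : Fin n → S)
    (hgen : ∀ U : X.Opens, IsAffineOpen U → Nonempty U → Submodule.span Γ(X, U)
      (Set.range fun i => (ofMem V S U (s i).1 (s i).2 : Γ(generatedSheaf V S, U))) = ⊤) :
    Epi (presentation (X := X) V S s) := by
  refine epi_of_surjective_app_of_isAffineOpen _ fun U hU => ?_
  rcases isEmpty_or_nonempty U with hUe | hUn
  · intro y
    exact ⟨0, by rw [map_zero, section_eq_zero_of_isEmpty V S hUe y]⟩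
  · exact presentation_app_surjective V S s U (hgen U hU hUn)

/-- **The presentation sequence `0 → 𝒦 → 𝒪_X^n → 𝒪_X · S → 0`** (`𝒦 = ker`) is short exact when the
presentation is an epimorphism. [this work] -/
theorem shortExact_kernel_presentation {n : ℕ} (s : Fin n → S) [Epi (presentation (X := X) V S s)] :
    (ShortComplex.mk (kernel.ι (presentation (X := X) V S s)) (presentation V S s)
      (kernel.condition _)).ShortExact :=
  ShortComplex.ShortExact.mk' (ShortComplex.exact_of_f_is_kernel _ (kernelIsKernel _))
    inferInstance inferInstance

/-- **The kernel of the presentation is affine-localizing** (quasi-coherent), for `X` locally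
Noetherian: kernel of a morphism between affine-localizing modules (`𝒪_X^n` coherent,
`isAffineLocalizing_generatedSheaf`). [this work] -/
theorem isAffineLocalizing_kernel_presentation [IsLocallyNoetherian X] {n : ℕ} (s : Fin n → S) :
    IsAffineLocalizing (kernel (presentation (X := X) V S s)) :=
  IsAffineLocalizing.kernel _ (coh_freeMod (X := X) n).loc (isAffineLocalizing_generatedSheaf V S)

/-! ## Full sheaves of `T`-modules: `T` acts through `Γ(X, U)` -/

section Base

variable {T : Type u} [CommRing T] (π : X ⟶ Spec (.of T))

/-- The structure map `T → Γ(X, 𝒪_X) → Γ(X, U)` followed by `evalFn U y : Γ(X, U) → K(X)` is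
`baseToFunctionField π` (both are «restrict to the generic point»). [this work] -/
theorem evalFn_res_algebraMapΓ (U : X.Opens) (y : U) (a : T) :
    evalFn U y (X.presheaf.map (homOfLE le_top).op (algebraMapΓ π a)) = baseToFunctionField π a := by
  haveI : Nonempty U := ⟨y⟩
  haveI : Nonempty (⊤ : X.Opens) := ⟨⟨y.1, trivial⟩⟩
  rw [evalFn_eq_germToFunctionField, germToFunctionField_map (le_top : U ≤ ⊤)]
  rfl

variable {M : Type u} [AddCommGroup M] [Module T M] {r : ℕ} (φ : M →+ (Fin r → X.functionField))

/-- **`σ_{φ(a • m)} = a|_U • σ_{φ m}`** over a non-empty open `U`, for `φ` semilinear along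
`baseToFunctionField π` (sections of `𝒪_X · φ(M)` are determined by their value). [this work] -/
theorem ofMem_map_smul (hφ : ∀ (a : T) (m : M), φ (a • m) = baseToFunctionField π a • φ m)
    (U : X.Opens) [Nonempty U] (a : T) (m : M) :
    (ofMem (Fin r → X.functionField) (Set.range φ) U (φ (a • m)) ⟨a • m, rfl⟩ :
        Γ(generatedSheaf (Fin r → X.functionField) (Set.range φ), U)) =
      (X.presheaf.map (homOfLE (le_top : U ≤ ⊤)).op (algebraMapΓ π a) : Γ(X, U)) •
        ofMem (Fin r → X.functionField) (Set.range φ) U (φ m) ⟨m, rfl⟩ := by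
  refine section_ext _ _ (funext fun y => ?_)
  rw [fn_ofMem, fn_smul, fn_ofMem, evalFn_res_algebraMapΓ, hφ]

/-- `σ_{φ(m + m')} = σ_{φ m} + σ_{φ m'}`. [this work] -/
theorem ofMem_map_add (U : X.Opens) (m m' : M) :
    (ofMem (Fin r → X.functionField) (Set.range φ) U (φ (m + m')) ⟨m + m', rfl⟩ :
        Γ(generatedSheaf (Fin r → X.functionField) (Set.range φ), U)) =
      ofMem (Fin r → X.functionField) (Set.range φ) U (φ m) ⟨m, rfl⟩ +
        ofMem (Fin r → X.functionField) (Set.range φ) U (φ m') ⟨m', rfl⟩ := by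
  refine section_ext _ _ (funext fun y => ?_)
  rw [fn_ofMem, fn_add, Pi.add_apply, fn_ofMem, fn_ofMem, map_add]

/-- `σ_{φ 0} = 0`. [this work] -/
theorem ofMem_map_zero (U : X.Opens) :
    (ofMem (Fin r → X.functionField) (Set.range φ) U (φ 0) ⟨0, rfl⟩ :
        Γ(generatedSheaf (Fin r → X.functionField) (Set.range φ), U)) = 0 := by
  refine section_ext _ _ (funext fun y => ?_)
  rw [fn_ofMem, fn_zero, Pi.zero_apply, map_zero]

/-- **Generators of `M` present the full sheaf**: if `m : J → M` spans `M` over `T`, then over every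
non-empty AFFINE open `U` the sections `σ_{φ(m j)}|_U` span `Γ(U, 𝒪_X · φ(M))` over `Γ(X, U)`
(`span_range_ofMem_eq_top`: all the `σ_{φ m'}`, `m' ∈ M`, do; and `σ_{φ(Σ aⱼ mⱼ)} = Σ aⱼ|_U • σ_{φ mⱼ}`).
[this work] -/
theorem span_range_ofMem_generators_eq_top
    (hφ : ∀ (a : T) (m : M), φ (a • m) = baseToFunctionField π a • φ m)
    {J : Type*} (m : J → M) (hm : Submodule.span T (Set.range m) = ⊤)
    {U : X.Opens} (hU : IsAffineOpen U) [Nonempty U] :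
    Submodule.span Γ(X, U) (Set.range fun j =>
      (ofMem (Fin r → X.functionField) (Set.range φ) U (φ (m j)) ⟨m j, rfl⟩ :
        Γ(generatedSheaf (Fin r → X.functionField) (Set.range φ), U))) = ⊤ := by
  set W := Submodule.span Γ(X, U) (Set.range fun j =>
      (ofMem (Fin r → X.functionField) (Set.range φ) U (φ (m j)) ⟨m j, rfl⟩ :
        Γ(generatedSheaf (Fin r → X.functionField) (Set.range φ), U))) with hW
  -- every `σ_{φ m'}`, `m' ∈ M`, lies in `W`
  have key : ∀ m' : M, (ofMem (Fin r → X.functionField) (Set.range φ) U (φ m') ⟨m', rfl⟩ :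
      Γ(generatedSheaf (Fin r → X.functionField) (Set.range φ), U)) ∈ W := by
    intro m'
    have hm' : m' ∈ Submodule.span T (Set.range m) := by rw [hm]; trivial
    induction hm' using Submodule.span_induction with
    | mem w hw =>
      obtain ⟨j, rfl⟩ := hw
      exact Submodule.subset_span ⟨j, rfl⟩
    | zero => rw [ofMem_map_zero]; exact W.zero_mem
    | add w w' _ _ hw hw' => rw [ofMem_map_add]; exact W.add_mem hw hw'
    | smul a w _ hw => rw [ofMem_map_smul π φ hφ]; exact W.smul_mem _ hw
  -- and those span everything (`span_range_ofMem_eq_top`)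
  refine eq_top_iff.mpr ?_
  rw [← span_range_ofMem_eq_top (Fin r → X.functionField) (Set.range φ) hU]
  refine Submodule.span_le.mpr ?_
  rintro _ ⟨⟨v, ⟨m', rfl⟩⟩, rfl⟩
  exact key m'

end Base

/-! ## G2 (iii): `Ȟ¹(𝒰, M~) = 0` -/

/-- **G2 (iii): `Ȟ¹(𝒰, M~) = 0` on every finite affine open cover.** Let `T` be a Noetherian local
domain of Krull dimension `2`, `π : X ⟶ Spec T` a resolution of singularities (`X` integral, regular,
`π` proper birational) with `Ȟ¹(𝒰, 𝒪_X) = 0` on all finite affine covers (`HasTrivialCechH1 π`), `M`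
a finite `T`-module and `φ : M →+ K(X)^r` additive and `T`-semilinear along `baseToFunctionField π`;
`M~ := 𝒪_X · φ(M)` (`generatedSheaf`). Then `Ȟ¹(𝒰, M~) = 0` for every finite affine open cover `𝒰`
of `X`: `n` generators of `M` give a presentation `0 → 𝒦 → 𝒪_X^n → M~ → 0` with `𝒦`
affine-localizing (`span_range_ofMem_generators_eq_top`, `epi_presentation`); `Ȟ¹(𝒰, 𝒪_X^n) = 0`
and `Ȟ¹` is right exact because `Ȟ²(𝒰, 𝒦) = 0` — the named fact `GortzWedhorn2023_24_44_H2`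
(`h24`; EGA III (4.2.2)) for the proper `π` whose fibres have dimension `≤ 1`
(`IsResolution.topologicalKrullDim_fiber_le_one`, using `hdim`). Statement = clause (iii) of the
holder's `SketchG2Split.lean` with the two extra binders `hdim`, `h24`. [this work] -/
theorem fullSheaf_cechMH1_subsingleton (T : Type) [CommRing T] [IsDomain T] [IsNoetherianRing T]
    [IsLocalRing T] (X : Scheme.{0}) [IsIntegral X] [IsLocallyNoetherian X]
    (π : X ⟶ Spec (.of T)) (M : Type) [AddCommGroup M] [Module T M] [Module.Finite T M] {r : ℕ}
    (φ : M →+ (Fin r → X.functionField)) (hdim : ringKrullDim T = 2) (hπ : IsResolution π)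
    (hrat : HasTrivialCechH1 π) (h24 : GortzWedhorn2023_24_44_H2.{0})
    (hφ : ∀ (a : T) (m : M), φ (a • m) = baseToFunctionField π a • φ m)
    {ι : Type} [Finite ι] (U : ι → X.Opens) (hU : ∀ i, IsAffineOpen (U i)) (hcov : ⨆ i, U i = ⊤) :
    Subsingleton (CechMH1 π (generatedSheaf (Fin r → X.functionField) (Set.range φ)) U) := by
  haveI : IsProper π := hπ.isProper
  -- `X` is separated (proper over the affine base)
  haveI : X.IsSeparated := ⟨by rw [← terminal.comp_from π]; infer_instance⟩
  -- generators of `M` and the presentation `𝒪_X^n ⟶ M~`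
  obtain ⟨n, m, hm⟩ := Module.Finite.exists_fin (R := T) (M := M)
  let s : Fin n → Set.range φ := fun k => ⟨φ (m k), ⟨m k, rfl⟩⟩
  haveI : Epi (presentation (X := X) (Fin r → X.functionField) (Set.range φ) s) :=
    epi_presentation _ _ s fun W hW hWn => by
      haveI := hWn
      exact span_range_ofMem_generators_eq_top (X := X) π φ hφ m hm hW
  have hS := shortExact_kernel_presentation (X := X) (Fin r → X.functionField) (Set.range φ) s
  have hK : IsAffineLocalizing (kernel (presentation (X := X) (Fin r → X.functionField) (Set.range φ) s)) :=
    isAffineLocalizing_kernel_presentation (X := X) _ _ s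
  -- `Ȟ¹(𝒰, 𝒪_X) = 0` (rationality) and `Ȟ²(𝒰, 𝒦) = 0` (Görtz–Wedhorn II 24.44 on the curve-fibred `X`)
  have hO : Subsingleton (CechH1 π U) := hrat ι U hU hcov
  have hfib : ∀ y : Spec (.of T), topologicalKrullDim (π.fiber y) ≤ 1 :=
    hπ.topologicalKrullDim_fiber_le_one hdim.le
  have hH2 : Subsingleton (CechMH2 π
      (kernel (presentation (X := X) (Fin r → X.functionField) (Set.range φ) s)) U) :=
    h24 T X π hfib _ hK ι U hU hcov
  have e : (freeMod X n : X.Modules) ≅ SheafOfModules.free (R := X.ringCatSheaf) (ULift.{0} (Fin n)) :=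
    Iso.refl _
  have key := subsingleton_cechMH1_of_shortExact_of_iso_free_of_isSeparated (I := ULift.{0} (Fin n)) π U
    hS e hK hU hO hH2
  -- `key` is about `S.X₃`; `convert` isolates the definitional unfolding `S.X₃ = M~`
  convert key using 2

/-- **G2 (iii) under the DOOR's TARGET INSTANCE (DR-F53 (a); V35c recipe §R3: first consumer of
`…Theorems.HomologicalConductorNoZenoGWH2Instance`).** The statement of `fullSheaf_cechMH1_subsingleton` with the
named-fact binder `(h24 : GortzWedhorn2023_24_44_H2)` replaced by the WEAKER OURS instance
`(h24 : NoZeno.GWH2ProperBirationalDim2)`: the base `T` is a Noetherian local DOMAIN of Krull dimension `2`, `X` is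
integral and the resolution `π` is proper birational (`IsResolution.isProper` / `.isBirational`), so the instance applies
verbatim at the single use `Ȟ²(𝒰, 𝒦) = 0`; everything else as in the proof above.  The general-binder theorem above is
its special case `fullSheaf_cechMH1_subsingleton_inst … (gwH2ProperBirationalDim2_of_GW h24) …` (left byte-identical:
append-only protocol).  `GWH2ProperBirationalDim2` is an unproved hypothesis; nothing is discharged. [this work] -/
theorem fullSheaf_cechMH1_subsingleton_inst (T : Type) [CommRing T] [IsDomain T] [IsNoetherianRing T]
    [IsLocalRing T] (X : Scheme.{0}) [IsIntegral X] [IsLocallyNoetherian X]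
    (π : X ⟶ Spec (.of T)) (M : Type) [AddCommGroup M] [Module T M] [Module.Finite T M] {r : ℕ}
    (φ : M →+ (Fin r → X.functionField)) (hdim : ringKrullDim T = 2) (hπ : IsResolution π)
    (hrat : HasTrivialCechH1 π) (h24 : GWH2ProperBirationalDim2)
    (hφ : ∀ (a : T) (m : M), φ (a • m) = baseToFunctionField π a • φ m)
    {ι : Type} [Finite ι] (U : ι → X.Opens) (hU : ∀ i, IsAffineOpen (U i)) (hcov : ⨆ i, U i = ⊤) :
    Subsingleton (CechMH1 π (generatedSheaf (Fin r → X.functionField) (Set.range φ)) U) := by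
  haveI : IsProper π := hπ.isProper
  -- `X` is separated (proper over the affine base)
  haveI : X.IsSeparated := ⟨by rw [← terminal.comp_from π]; infer_instance⟩
  -- generators of `M` and the presentation `𝒪_X^n ⟶ M~`
  obtain ⟨n, m, hm⟩ := Module.Finite.exists_fin (R := T) (M := M)
  let s : Fin n → Set.range φ := fun k => ⟨φ (m k), ⟨m k, rfl⟩⟩
  haveI : Epi (presentation (X := X) (Fin r → X.functionField) (Set.range φ) s) :=
    epi_presentation _ _ s fun W hW hWn => by
      haveI := hWn
      exact span_range_ofMem_generators_eq_top (X := X) π φ hφ m hm hW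
  have hS := shortExact_kernel_presentation (X := X) (Fin r → X.functionField) (Set.range φ) s
  have hK : IsAffineLocalizing (kernel (presentation (X := X) (Fin r → X.functionField) (Set.range φ) s)) :=
    isAffineLocalizing_kernel_presentation (X := X) _ _ s
  -- `Ȟ¹(𝒰, 𝒪_X) = 0` (rationality) and `Ȟ²(𝒰, 𝒦) = 0` (the instance: `T` a 2-dim local domain, `π` proper birational)
  have hO : Subsingleton (CechH1 π U) := hrat ι U hU hcov
  have hH2 : Subsingleton (CechMH2 π
      (kernel (presentation (X := X) (Fin r → X.functionField) (Set.range φ) s)) U) :=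
    h24 T hdim.le X π hπ.isBirational _ hK ι U hU hcov
  have e : (freeMod X n : X.Modules) ≅ SheafOfModules.free (R := X.ringCatSheaf) (ULift.{0} (Fin n)) :=
    Iso.refl _
  have key := subsingleton_cechMH1_of_shortExact_of_iso_free_of_isSeparated (I := ULift.{0} (Fin n)) π U
    hS e hK hU hO hH2
  -- `key` is about `S.X₃`; `convert` isolates the definitional unfolding `S.X₃ = M~`
  convert key using 2

/-- **G2 (iii) under the RESOLUTION instance `GWH2ResolutionDim2` (desk re-cut r2 / §R3b, after p613816).** The statement
of `fullSheaf_cechMH1_subsingleton` with the named-fact binder replaced by the still WEAKER OURS instance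
`(h24 : NoZeno.GWH2ResolutionDim2)` (`…Theorems.HomologicalConductorNoZenoGWH2Instance`, §R3b): `π` IS a resolution of the
spectrum of the 2-dimensional Noetherian local domain `T` with `X` integral and locally Noetherian, so the instance applies verbatim
at the single use `Ȟ²(𝒰, 𝒦) = 0`.  The two theorems above are its special cases via `gwH2ResolutionDim2_of_GW` /
`gwH2ResolutionDim2_of_properBirational` (left byte-identical: append-only protocol).  Nothing is discharged. [this work] -/
theorem fullSheaf_cechMH1_subsingleton_instRes (T : Type) [CommRing T] [IsDomain T] [IsNoetherianRing T]
    [IsLocalRing T] (X : Scheme.{0}) [IsIntegral X] [IsLocallyNoetherian X]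
    (π : X ⟶ Spec (.of T)) (M : Type) [AddCommGroup M] [Module T M] [Module.Finite T M] {r : ℕ}
    (φ : M →+ (Fin r → X.functionField)) (hdim : ringKrullDim T = 2) (hπ : IsResolution π)
    (hrat : HasTrivialCechH1 π) (h24 : GWH2ResolutionDim2)
    (hφ : ∀ (a : T) (m : M), φ (a • m) = baseToFunctionField π a • φ m)
    {ι : Type} [Finite ι] (U : ι → X.Opens) (hU : ∀ i, IsAffineOpen (U i)) (hcov : ⨆ i, U i = ⊤) :
    Subsingleton (CechMH1 π (generatedSheaf (Fin r → X.functionField) (Set.range φ)) U) := by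
  haveI : IsProper π := hπ.isProper
  -- `X` is separated (proper over the affine base)
  haveI : X.IsSeparated := ⟨by rw [← terminal.comp_from π]; infer_instance⟩
  -- generators of `M` and the presentation `𝒪_X^n ⟶ M~`
  obtain ⟨n, m, hm⟩ := Module.Finite.exists_fin (R := T) (M := M)
  let s : Fin n → Set.range φ := fun k => ⟨φ (m k), ⟨m k, rfl⟩⟩
  haveI : Epi (presentation (X := X) (Fin r → X.functionField) (Set.range φ) s) :=
    epi_presentation _ _ s fun W hW hWn => by
      haveI := hWn
      exact span_range_ofMem_generators_eq_top (X := X) π φ hφ m hm hW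
  have hS := shortExact_kernel_presentation (X := X) (Fin r → X.functionField) (Set.range φ) s
  have hK : IsAffineLocalizing (kernel (presentation (X := X) (Fin r → X.functionField) (Set.range φ) s)) :=
    isAffineLocalizing_kernel_presentation (X := X) _ _ s
  -- `Ȟ¹(𝒰, 𝒪_X) = 0` (rationality) and `Ȟ²(𝒰, 𝒦) = 0` (the resolution instance)
  have hO : Subsingleton (CechH1 π U) := hrat ι U hU hcov
  have hH2 : Subsingleton (CechMH2 π
      (kernel (presentation (X := X) (Fin r → X.functionField) (Set.range φ) s)) U) :=
    h24 T hdim X π hπ _ hK ι U hU hcov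
  have e : (freeMod X n : X.Modules) ≅ SheafOfModules.free (R := X.ringCatSheaf) (ULift.{0} (Fin n)) :=
    Iso.refl _
  have key := subsingleton_cechMH1_of_shortExact_of_iso_free_of_isSeparated (I := ULift.{0} (Fin n)) π U
    hS e hK hU hO hH2
  -- `key` is about `S.X₃`; `convert` isolates the definitional unfolding `S.X₃ = M~`
  convert key using 2

end Summit.ResolutionOfSingularities.ResolutionOfSingularities.Theorems.NoZeno.SandwichCluster.FullSheaf

end
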